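import Mathlib
import Literature.NumberTheory.LFunctions.Zhang2022.SkeletonPartThree
import HarnessLib

/-!
# Zhang (2022), Appendix B, (B.1) — core: `χ = μ ∗ ν`, `|ϱ_j − ϱ*_j| ≤ Σ ν·τ₂`, the divisor-sum swap

Topic `Literature/NumberTheory/LFunctions/Zhang2022` (Landau–Siegel audit tree; verdict-neutral).
Y. Zhang, *Discrete mean estimates and the Landau–Siegel zero*, arXiv:2211.02515v1 (2022)
[Zhang2022LandauSiegel] — **an unrefereed manuscript under adjudication**. This file PROVES display
**(B.1)** of Appendix B (proof of Lemma 15.1, p. 106 of the source, tex L5253–5268): with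
`ϱ_j(n) = Σ_{d∣n} μ(d)d^{β_j}`, `ϱ*_j(n) = Σ_{d∣n} d^{β_j}χ(d)` ((15.21), `Skeleton.varrhoStar`),
`ν = 1 ∗ χ` (`Skeleton.nu` = `divisorSumChar χ`), `𝔮 = ∏_{q<D⁴} q` (`Skeleton.frakq`), under
Assumption (A) and for `D` large,
"`Σ_{n<P, (n,𝔮)=1} |ϱ_j(n) − ϱ*_j(n)|/n ≪ 𝓛⁻⁸`" — the final bound is `AppendixBVarrhoB1.appB1_bound`
(companion file); THIS file kernel-checks the steps of the source in its own shape: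

* `Z22:§B.u002`–`u003`: "Since `χ = μ ∗ ν`, `χ(d) = μ(d) + O(Σ_{h∣d, h>1} ν(h))`" — here
  `χ(d) = Σ_{h∣d} μ(d/h)ν(h)` (`chi_eq_sum_moebius_mul_nu`, Möbius inversion) and
  `|χ(d) − μ(d)| ≤ Σ_{h∣d, h>1} |ν(h)|` (`norm_chi_sub_moebius_le`);
* `Z22:§B.u004`: "`ϱ_j(n) − ϱ*_j(n) ≪ Σ_{h∣n, h>1} ν(h)τ₂(n/h)`" (`norm_varrho_sub_le`, constant `1`);
* `Z22:§B.u005`: "`(h,𝔮) = 1`, `h > 1` ⇒ `h > D⁴`" and the substitution `n = hm`: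
  `Σ_{n≤X, (n,𝔮)=1} |ϱ_j − ϱ*_j|(n)/n ≤ (Σ_{k≤X} 1/k)² · Σ_{D⁴<h≤X} |ν(h)|/h` (`sum_coprime_norm_sub_le`;
  the source writes `≪ (log P)² Σ_{D⁴<h<P} ν(h)/h`);
* the last step. The source says "This together with Lemma 3.2 yields (B.1)"; Lemma 3.2 is the bound
  `Σ_{D⁴<n≤D⁸} ν(n)²τ₂(n)²/n ≪ 𝓛⁻²⁰⁰⁷` (range up to `D⁸ ≪ P`, another summand), which does not give
  the display as printed. What IS derivable, and is proved here, is the step from **Lemma 3.1**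
  (`Σ_{D⁴<n≤P²} ν(n)²/n ≪ 𝓛⁻²⁰¹¹` under (A) — a THEOREM of the tree, `Lemma31.lemma_3_1`) and
  Cauchy–Schwarz: `Σ_{D⁴<h≤X} |ν(h)|/h ≤ (Σ ν²/h)^{1/2}(Σ 1/h)^{1/2} ≪ 𝓛^{−1005}·𝓛^{9/2}`, whence
  (B.1) with the printed exponent `8` (in fact `≪ 𝓛⁻⁹⁷⁸`) — carried out in the companion file
  `AppendixBVarrhoB1`. This citation slip is recorded, not repaired silently.

DAG nodes (cell siegel-zhang): `Z22:§B.u002`–`§B.u005` (and the core of `Z22:(B.1)`). What is NOT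
here: the final `≪ 𝓛⁻⁸` (`AppendixBVarrhoB1`), (B.2) (`AppendixBVarrho`, `AppendixBVarrhoB2`), the rest
of the proof of Lemma 15.1, any claim about Theorems 1–2 of the source or about Landau–Siegel zeros.
-/

noncomputable section

open Complex Real Finset ArithmeticFunction

namespace Literature.NumberTheory.LFunctions.Zhang2022.AppendixBVarrho

open Literature.NumberTheory.LFunctions.Zhang2022 Skeleton

/-! ## `χ = μ ∗ ν` and `|χ(d) − μ(d)| ≤ Σ_{h∣d, h>1} |ν(h)|` -/

section Pointwise

variable {D : ℕ} (χ : DirichletCharacter ℂ D)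

/-- **`χ = μ ∗ ν`** (Möbius inversion of `ν = 1 ∗ χ`): `χ(d) = Σ_{h∣d} μ(d/h)ν(h)` for `d ≥ 1`
(`ν = divisorSumChar χ`). [cite: Zhang2022LandauSiegel, Appendix B (proof of (B.1))] -/
theorem chi_eq_sum_moebius_mul_nu {d : ℕ} (hd : d ≠ 0) :
    χ (d : ZMod D) = ∑ h ∈ d.divisors, (ArithmeticFunction.moebius (d / h) : ℂ) * divisorSumChar χ h := by
  have key : ((ArithmeticFunction.moebius : ArithmeticFunction ℂ) *
      (((ArithmeticFunction.zeta : ArithmeticFunction ℕ) : ArithmeticFunction ℂ) *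
        toArithmeticFunction (χ ·))) = toArithmeticFunction (χ ·) := by
    rw [← mul_assoc, coe_moebius_mul_coe_zeta, one_mul]
  have h := congrArg (fun f : ArithmeticFunction ℂ => f d) key
  simp only at h
  rw [mul_apply, Nat.sum_divisorsAntidiagonal' (fun a b =>
    (ArithmeticFunction.moebius : ArithmeticFunction ℂ) a *
      (((ArithmeticFunction.zeta : ArithmeticFunction ℕ) : ArithmeticFunction ℂ) *
        toArithmeticFunction (χ ·)) b)] at h
  have hχ : toArithmeticFunction (χ ·) d = χ (d : ZMod D) := by simp [toArithmeticFunction, hd]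
  rw [hχ] at h
  rw [← h]
  refine sum_congr rfl fun b _ => ?_
  rw [intCoe_apply, divisorSumChar_eq_zeta_mul]

/-- **`|χ(d) − μ(d)| ≤ Σ_{h∣d, h>1} |ν(h)|`** for `d ≥ 1` (the source: "`χ(d) = μ(d) + O(Σ_{h∣d,h>1} ν(h))`";
`|μ| ≤ 1`). [cite: Zhang2022LandauSiegel, Appendix B (proof of (B.1))] -/
theorem norm_chi_sub_moebius_le {d : ℕ} (hd : d ≠ 0) :
    ‖χ (d : ZMod D) - (ArithmeticFunction.moebius d : ℂ)‖ ≤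
      ∑ h ∈ d.divisors.erase 1, ‖divisorSumChar χ h‖ := by
  have h1 : (1 : ℕ) ∈ d.divisors := Nat.one_mem_divisors.mpr hd
  have hsplit := Finset.sum_erase_eq_sub (f := fun h =>
    (ArithmeticFunction.moebius (d / h) : ℂ) * divisorSumChar χ h) h1
  simp only [Nat.div_one, divisorSumChar_one, mul_one] at hsplit
  rw [chi_eq_sum_moebius_mul_nu χ hd, ← hsplit]
  refine (norm_sum_le _ _).trans (sum_le_sum fun h _ => ?_)
  rw [norm_mul]
  have hμ : ‖(ArithmeticFunction.moebius (d / h) : ℂ)‖ ≤ 1 := by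
    rw [Complex.norm_intCast]
    exact_mod_cast ArithmeticFunction.abs_moebius_le_one
  calc ‖(ArithmeticFunction.moebius (d / h) : ℂ)‖ * ‖divisorSumChar χ h‖
      ≤ 1 * ‖divisorSumChar χ h‖ := mul_le_mul_of_nonneg_right hμ (norm_nonneg _)
    _ = ‖divisorSumChar χ h‖ := one_mul _

/-- For `d ∣ n` (`n ≥ 1`) and `g ≥ 0`: `Σ_{d∣n} Σ_{h∣d, h>1} g(h) ≤ Σ_{h∣n, h>1} τ₂(n/h)·g(h)`
(the multiples of `h` among the divisors of `n` inject into the divisors of `n/h`). [folklore] -/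
private theorem sum_divisors_sum_le {n : ℕ} (hn : n ≠ 0) {g : ℕ → ℝ} (hg : ∀ h, 0 ≤ g h) :
    ∑ d ∈ n.divisors, ∑ h ∈ d.divisors.erase 1, g h ≤
      ∑ h ∈ n.divisors.erase 1, ((n / h).divisors.card : ℝ) * g h := by
  -- rewrite the inner sums over the fixed index set `n.divisors.erase 1`
  have hinner : ∀ d ∈ n.divisors, ∑ h ∈ d.divisors.erase 1, g h =
      ∑ h ∈ n.divisors.erase 1, if h ∣ d then g h else 0 := by
    intro d hdn
    rw [← sum_filter]
    refine sum_congr ?_ fun _ _ => rfl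
    ext h
    have hd0 : d ≠ 0 := (Nat.pos_of_mem_divisors hdn).ne'
    simp only [mem_erase, Nat.mem_divisors, mem_filter]
    constructor
    · rintro ⟨hh1, hhd, -⟩
      exact ⟨⟨hh1, hhd.trans (Nat.dvd_of_mem_divisors hdn), hn⟩, hhd⟩
    · rintro ⟨⟨hh1, -, -⟩, hhd⟩
      exact ⟨hh1, hhd, hd0⟩
  rw [sum_congr rfl hinner, sum_comm]
  refine sum_le_sum fun h hh => ?_
  rw [← sum_filter, sum_const, nsmul_eq_mul]
  refine mul_le_mul_of_nonneg_right ?_ (hg h)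
  have hh0 : 0 < h := Nat.pos_of_mem_divisors (mem_of_mem_erase hh)
  -- `{d ∣ n : h ∣ d} ⊆ h · divisors (n/h)`
  have hsub : n.divisors.filter (fun d => h ∣ d) ⊆ ((n / h).divisors).image (fun e => h * e) := by
    intro d hd
    rw [mem_filter] at hd
    obtain ⟨hdn, ⟨e, rfl⟩⟩ := hd
    refine mem_image.mpr ⟨e, ?_, rfl⟩
    rw [Nat.mem_divisors]
    refine ⟨Nat.dvd_div_of_mul_dvd (Nat.dvd_of_mem_divisors hdn), ?_⟩
    intro h0
    rcases (Nat.div_eq_zero_iff).mp h0 with h' | h'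
    · omega
    · exact absurd (Nat.le_of_dvd (Nat.pos_of_ne_zero hn)
        ((dvd_mul_right h e).trans (Nat.dvd_of_mem_divisors hdn))) (by omega)
  exact_mod_cast (card_le_card hsub).trans card_image_le

/-- **`|ϱ_j(n) − ϱ*_j(n)| ≤ Σ_{h∣n, h>1} |ν(h)|τ₂(n/h)`** for `n ≥ 1` and `Re β = 0` (the source:
"`ϱ_j(n) − ϱ*_j(n) ≪ Σ_{h∣n,h>1} ν(h)τ₂(n/h)`"; `|d^β| = 1`). [cite: Zhang2022LandauSiegel, Appendix B (proof of (B.1))] -/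
theorem norm_varrho_sub_le {β : ℂ} (hβ : β.re = 0) {n : ℕ} (hn : n ≠ 0) :
    ‖(∑ d ∈ n.divisors, (ArithmeticFunction.moebius d : ℂ) * (d : ℂ) ^ β) -
        ∑ d ∈ n.divisors, (d : ℂ) ^ β * χ (d : ZMod D)‖ ≤
      ∑ h ∈ n.divisors.erase 1, ((n / h).divisors.card : ℝ) * ‖divisorSumChar χ h‖ := by
  rw [← sum_sub_distrib]
  calc ‖∑ d ∈ n.divisors, ((ArithmeticFunction.moebius d : ℂ) * (d : ℂ) ^ β - (d : ℂ) ^ β * χ (d : ZMod D))‖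
      ≤ ∑ d ∈ n.divisors, ‖(ArithmeticFunction.moebius d : ℂ) * (d : ℂ) ^ β - (d : ℂ) ^ β * χ (d : ZMod D)‖ :=
        norm_sum_le _ _
    _ ≤ ∑ d ∈ n.divisors, ∑ h ∈ d.divisors.erase 1, ‖divisorSumChar χ h‖ := by
        refine sum_le_sum fun d hd => ?_
        have hd0 : 0 < d := Nat.pos_of_mem_divisors hd
        have hnd : ‖(d : ℂ) ^ β‖ = 1 := by
          rw [Complex.norm_natCast_cpow_of_pos hd0, hβ, Real.rpow_zero]
        calc ‖(ArithmeticFunction.moebius d : ℂ) * (d : ℂ) ^ β - (d : ℂ) ^ β * χ (d : ZMod D)‖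
            = ‖(d : ℂ) ^ β‖ * ‖χ (d : ZMod D) - (ArithmeticFunction.moebius d : ℂ)‖ := by
              rw [← norm_mul, ← norm_neg]; congr 1; ring
          _ ≤ ∑ h ∈ d.divisors.erase 1, ‖divisorSumChar χ h‖ := by
              rw [hnd, one_mul]; exact norm_chi_sub_moebius_le χ hd0.ne'
    _ ≤ ∑ h ∈ n.divisors.erase 1, ((n / h).divisors.card : ℝ) * ‖divisorSumChar χ h‖ :=
        sum_divisors_sum_le hn fun h => norm_nonneg _

end Pointwise

/-! ## Swapping the divisor sums: `Σ_{n≤X,(n,𝔮)=1} |ϱ_j−ϱ*_j|(n)/n ≤ (Σ_{k≤X} 1/k)²·Σ_{D⁴<h≤X}|ν(h)|/h` -/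

/-- `∑_{n ≤ Y} ∑_{d ∣ n} F(d, n) = ∑_{d ≤ Y} ∑_{m ≤ Y/d} F(d, dm)`. [folklore] -/
private theorem sum_Icc_sum_divisors_eq {M : Type*} [AddCommMonoid M] (F : ℕ → ℕ → M) (Y : ℕ) :
    ∑ n ∈ Icc 1 Y, ∑ d ∈ n.divisors, F d n =
      ∑ d ∈ Icc 1 Y, ∑ m ∈ Icc 1 (Y / d), F d (d * m) := by
  -- adapted from Literature/NumberTheory/LFunctions/HalaszPartialSummation.lean
  rw [Finset.sum_sigma', Finset.sum_sigma']
  refine Finset.sum_bij' (fun x _ => ⟨x.2, x.1 / x.2⟩) (fun x _ => ⟨x.1 * x.2, x.1⟩) ?_ ?_ ?_ ?_ ?_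
  · rintro ⟨n, d⟩ hx
    simp only [Finset.mem_sigma, Finset.mem_Icc, Nat.mem_divisors] at hx ⊢
    obtain ⟨⟨hn1, hnY⟩, hdn, hn0⟩ := hx
    have hd0 : 0 < d := Nat.pos_of_dvd_of_pos hdn (by omega)
    refine ⟨⟨hd0, (Nat.le_of_dvd (by omega) hdn).trans hnY⟩, ?_, Nat.div_le_div_right hnY⟩
    exact Nat.div_pos (Nat.le_of_dvd (by omega) hdn) hd0
  · rintro ⟨d, m⟩ hx
    simp only [Finset.mem_sigma, Finset.mem_Icc, Nat.mem_divisors] at hx ⊢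
    obtain ⟨⟨hd1, hdY⟩, hm1, hmY⟩ := hx
    refine ⟨⟨Nat.mul_pos hd1 hm1, ?_⟩, Dvd.intro m rfl, (Nat.mul_pos hd1 hm1).ne'⟩
    calc d * m ≤ d * (Y / d) := Nat.mul_le_mul_left d hmY
      _ ≤ Y := Nat.mul_div_le Y d
  · rintro ⟨n, d⟩ hx
    simp only [Finset.mem_sigma, Finset.mem_Icc, Nat.mem_divisors] at hx
    obtain ⟨⟨hn1, hnY⟩, hdn, hn0⟩ := hx
    simp only [Nat.mul_div_cancel' hdn]
  · rintro ⟨d, m⟩ hx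
    simp only [Finset.mem_sigma, Finset.mem_Icc] at hx
    obtain ⟨⟨hd1, hdY⟩, hm1, hmY⟩ := hx
    simp only [Nat.mul_div_cancel_left m hd1]
  · rintro ⟨n, d⟩ hx
    simp only [Finset.mem_sigma, Finset.mem_Icc, Nat.mem_divisors] at hx
    obtain ⟨⟨hn1, hnY⟩, hdn, hn0⟩ := hx
    simp only [Nat.mul_div_cancel' hdn]

/-- `Σ_{m≤X} τ₂(m)/m ≤ (Σ_{k≤X} 1/k)²` (the source's "`Σ_{m<P/h} τ₂(m)/m ≪ (log P)²`"). [folklore] -/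
private theorem sum_card_divisors_div_le (X : ℕ) :
    ∑ m ∈ Icc 1 X, (m.divisors.card : ℝ) / m ≤ (∑ k ∈ Icc 1 X, (1 : ℝ) / k) ^ 2 := by
  have h1 : ∑ m ∈ Icc 1 X, (m.divisors.card : ℝ) / m =
      ∑ m ∈ Icc 1 X, ∑ d ∈ m.divisors, (1 : ℝ) / m := by
    refine sum_congr rfl fun m _ => ?_
    rw [sum_const, nsmul_eq_mul, mul_one_div]
  rw [h1, sum_Icc_sum_divisors_eq (fun _ m => (1 : ℝ) / m) X, sq, sum_mul]
  refine sum_le_sum fun d hd => ?_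
  have hd0 : (0 : ℝ) < d := by simp only [mem_Icc] at hd; exact_mod_cast hd.1
  rw [mul_sum]
  calc ∑ m ∈ Icc 1 (X / d), (1 : ℝ) / ((d * m : ℕ) : ℝ)
      ≤ ∑ m ∈ Icc 1 X, (1 : ℝ) / ((d * m : ℕ) : ℝ) := by
        refine sum_le_sum_of_subset_of_nonneg ?_ fun m _ _ => by positivity
        intro m hm; simp only [mem_Icc] at hm ⊢; exact ⟨hm.1, hm.2.trans (Nat.div_le_self X d)⟩
    _ = ∑ m ∈ Icc 1 X, 1 / (d : ℝ) * (1 / m) := by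
        refine sum_congr rfl fun m _ => ?_
        push_cast
        rw [one_div_mul_one_div]

/-- A number `b > 1` coprime to `Q` exceeds `Y` if every prime `≤ Y` divides `Q` (the source: "If
`h > 1` and `(h,𝔮) = 1`, then `h > D⁴`"). [cite: Zhang2022LandauSiegel, Appendix B (proof of (B.1))] -/
theorem lt_of_coprime_of_primes_dvd {Q Y b : ℕ} (hQ : ∀ p, p.Prime → p ≤ Y → p ∣ Q)
    (hb0 : b ≠ 0) (hb1 : b ≠ 1) (hbQ : Nat.Coprime b Q) : Y < b := by
  obtain ⟨p, hp, hpb⟩ := Nat.exists_prime_and_dvd hb1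
  by_contra hY
  push Not at hY
  have hpQ := hQ p hp ((Nat.le_of_dvd (Nat.pos_of_ne_zero hb0) hpb).trans hY)
  have h1 : p ∣ Nat.gcd b Q := Nat.dvd_gcd hpb hpQ
  rw [Nat.Coprime.gcd_eq_one hbQ] at h1
  exact hp.one_lt.ne' (Nat.dvd_one.mp h1)

/-- **The substitution `n = hm` (`Z22:§B.u004`, first relation).** For `Re β = 0`, any `Q` and any `X`:
`Σ_{n≤X, (n,Q)=1} |ϱ(n) − ϱ*(n)|/n ≤ Σ_{h≤X, (h,Q)=1, h>1} (|ν(h)|/h) · Σ_{m≤X/h} τ₂(m)/m`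
(the source's "`≪ Σ_{h>D⁴} ν(h)/h Σ_{m<P/h} τ₂(m)/m`", implied constant `1`).
[cite: Zhang2022LandauSiegel, Appendix B (proof of (B.1))] -/
theorem sum_coprime_norm_sub_le_swap {D : ℕ} (χ : DirichletCharacter ℂ D) {β : ℂ} (hβ : β.re = 0)
    (Q X : ℕ) :
    ∑ n ∈ (Icc 1 X).filter (fun n => Nat.Coprime n Q),
      ‖(∑ d ∈ n.divisors, (ArithmeticFunction.moebius d : ℂ) * (d : ℂ) ^ β) -
          ∑ d ∈ n.divisors, (d : ℂ) ^ β * χ (d : ZMod D)‖ / n ≤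
      ∑ h ∈ (Icc 1 X).filter (fun h => Nat.Coprime h Q ∧ h ≠ 1),
        ‖divisorSumChar χ h‖ / h * ∑ m ∈ Icc 1 (X / h), (m.divisors.card : ℝ) / m := by
  set ν : ℕ → ℝ := fun h => ‖divisorSumChar χ h‖ with hν
  -- the summand after the pointwise bound, as a function of the pair `(h, n)`
  set F : ℕ → ℕ → ℝ := fun h n =>
    if Nat.Coprime n Q ∧ h ≠ 1 then ((n / h).divisors.card : ℝ) * ν h / n else 0 with hF
  have hF0 : ∀ h n, 0 ≤ F h n := by
    intro h n; simp only [hF]; split_ifs <;> positivity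
  -- the weight in `h` after the substitution `n = hm`
  set G : ℕ → ℝ := fun h => if Nat.Coprime h Q ∧ h ≠ 1 then ν h / h else 0 with hG
  have hG0 : ∀ h, 0 ≤ G h := by
    intro h; simp only [hG]; split_ifs <;> positivity
  -- Step 1: pointwise bound and passage to the double sum over `n ≤ X`, `h ∣ n`
  have step1 : ∑ n ∈ (Icc 1 X).filter (fun n => Nat.Coprime n Q),
      ‖(∑ d ∈ n.divisors, (ArithmeticFunction.moebius d : ℂ) * (d : ℂ) ^ β) -
          ∑ d ∈ n.divisors, (d : ℂ) ^ β * χ (d : ZMod D)‖ / n ≤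
      ∑ n ∈ Icc 1 X, ∑ h ∈ n.divisors, F h n := by
    calc ∑ n ∈ (Icc 1 X).filter (fun n => Nat.Coprime n Q),
          ‖(∑ d ∈ n.divisors, (ArithmeticFunction.moebius d : ℂ) * (d : ℂ) ^ β) -
            ∑ d ∈ n.divisors, (d : ℂ) ^ β * χ (d : ZMod D)‖ / n
        ≤ ∑ n ∈ (Icc 1 X).filter (fun n => Nat.Coprime n Q), ∑ h ∈ n.divisors, F h n := by
          refine sum_le_sum fun n hn => ?_
          obtain ⟨hnX, hnQ⟩ := mem_filter.mp hn
          have hn0 : n ≠ 0 := by simp only [mem_Icc] at hnX; omega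
          have hn0' : (0 : ℝ) < n := by exact_mod_cast Nat.pos_of_ne_zero hn0
          calc ‖(∑ d ∈ n.divisors, (ArithmeticFunction.moebius d : ℂ) * (d : ℂ) ^ β) -
                ∑ d ∈ n.divisors, (d : ℂ) ^ β * χ (d : ZMod D)‖ / n
              ≤ (∑ h ∈ n.divisors.erase 1, ((n / h).divisors.card : ℝ) * ν h) / n :=
                div_le_div_of_nonneg_right (norm_varrho_sub_le χ hβ hn0) hn0'.le
            _ = ∑ h ∈ n.divisors, F h n := by
                rw [← Finset.filter_ne', sum_filter, sum_div]
                refine sum_congr rfl fun h _ => ?_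
                by_cases h1 : h ≠ 1
                · have hc : Nat.Coprime n Q ∧ h ≠ 1 := ⟨hnQ, h1⟩
                  simp only [hF, if_pos h1, if_pos hc]
                · have hc : ¬ (Nat.Coprime n Q ∧ h ≠ 1) := fun hc => h1 hc.2
                  simp only [hF, if_neg h1, if_neg hc, zero_div]
      _ ≤ ∑ n ∈ Icc 1 X, ∑ h ∈ n.divisors, F h n :=
          sum_le_sum_of_subset_of_nonneg (filter_subset _ _) fun n _ _ =>
            sum_nonneg fun h _ => hF0 h n
  -- Step 2: swap, `n = hm`, and bound `F h (hm) ≤ G h · τ₂(m)/m`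
  have step2 : ∑ n ∈ Icc 1 X, ∑ h ∈ n.divisors, F h n ≤
      ∑ h ∈ Icc 1 X, G h * ∑ m ∈ Icc 1 (X / h), (m.divisors.card : ℝ) / m := by
    rw [sum_Icc_sum_divisors_eq F X]
    refine sum_le_sum fun h hh => ?_
    have hh0 : 0 < h := by simp only [mem_Icc] at hh; exact hh.1
    rw [mul_sum]
    refine sum_le_sum fun m hm => ?_
    have hm0 : 0 < m := by simp only [mem_Icc] at hm; exact hm.1
    simp only [hF, hG, Nat.mul_div_cancel_left m hh0]
    by_cases hc : Nat.Coprime (h * m) Q ∧ h ≠ 1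
    · rw [if_pos hc, if_pos ⟨Nat.Coprime.coprime_mul_right hc.1, hc.2⟩]
      push_cast
      have hh0' : (0 : ℝ) < h := by exact_mod_cast hh0
      have hm0' : (0 : ℝ) < m := by exact_mod_cast hm0
      field_simp
      rfl
    · rw [if_neg hc]
      exact mul_nonneg (hG0 h) (by positivity)
  -- Step 3: the `h`-weights as a filtered sum
  have step3 : ∑ h ∈ Icc 1 X, G h * ∑ m ∈ Icc 1 (X / h), (m.divisors.card : ℝ) / m =
      ∑ h ∈ (Icc 1 X).filter (fun h => Nat.Coprime h Q ∧ h ≠ 1),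
        ν h / h * ∑ m ∈ Icc 1 (X / h), (m.divisors.card : ℝ) / m := by
    rw [sum_filter]
    refine sum_congr rfl fun h _ => ?_
    simp only [hG]
    split_ifs <;> simp
  exact step1.trans (step2.trans step3.le)

/-- **The divisor-sum swap, summed (`Z22:§B.u004`).** For `Re β = 0`, any `Q`, `Y` with every prime
`≤ Y` dividing `Q`, and any `X`:
`Σ_{n≤X, (n,Q)=1} |ϱ(n) − ϱ*(n)|/n ≤ (Σ_{k≤X} 1/k)² · Σ_{Y<h≤X} |ν(h)|/h`
(the source's "`≪ (log P)² Σ_{D⁴<h<P} ν(h)/h`"). [cite: Zhang2022LandauSiegel, Appendix B (proof of (B.1))] -/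
theorem sum_coprime_norm_sub_le {D : ℕ} (χ : DirichletCharacter ℂ D) {β : ℂ} (hβ : β.re = 0)
    {Q Y : ℕ} (hQ : ∀ p, p.Prime → p ≤ Y → p ∣ Q) (X : ℕ) :
    ∑ n ∈ (Icc 1 X).filter (fun n => Nat.Coprime n Q),
      ‖(∑ d ∈ n.divisors, (ArithmeticFunction.moebius d : ℂ) * (d : ℂ) ^ β) -
          ∑ d ∈ n.divisors, (d : ℂ) ^ β * χ (d : ZMod D)‖ / n ≤
      (∑ k ∈ Icc 1 X, (1 : ℝ) / k) ^ 2 * ∑ h ∈ Ioc Y X, ‖divisorSumChar χ h‖ / h := by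
  set H : ℝ := ∑ k ∈ Icc 1 X, (1 : ℝ) / k with hH
  have hT : ∀ h ∈ (Icc 1 X).filter (fun h => Nat.Coprime h Q ∧ h ≠ 1),
      ‖divisorSumChar χ h‖ / h * ∑ m ∈ Icc 1 (X / h), (m.divisors.card : ℝ) / m ≤
        ‖divisorSumChar χ h‖ / h * H ^ 2 := by
    intro h _
    refine mul_le_mul_of_nonneg_left ?_ (by positivity)
    calc ∑ m ∈ Icc 1 (X / h), (m.divisors.card : ℝ) / m
        ≤ ∑ m ∈ Icc 1 X, (m.divisors.card : ℝ) / m := by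
          refine sum_le_sum_of_subset_of_nonneg ?_ fun m _ _ => by positivity
          intro m hm; simp only [mem_Icc] at hm ⊢; exact ⟨hm.1, hm.2.trans (Nat.div_le_self X h)⟩
      _ ≤ H ^ 2 := sum_card_divisors_div_le X
  have hsub : (Icc 1 X).filter (fun h => Nat.Coprime h Q ∧ h ≠ 1) ⊆ Ioc Y X := by
    intro h hh
    rw [mem_filter, mem_Icc] at hh
    obtain ⟨⟨hh1, hhX⟩, hhQ, hh1'⟩ := hh
    exact mem_Ioc.mpr ⟨lt_of_coprime_of_primes_dvd hQ (by omega) hh1' hhQ, hhX⟩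
  calc _ ≤ ∑ h ∈ (Icc 1 X).filter (fun h => Nat.Coprime h Q ∧ h ≠ 1),
          ‖divisorSumChar χ h‖ / h * ∑ m ∈ Icc 1 (X / h), (m.divisors.card : ℝ) / m :=
        sum_coprime_norm_sub_le_swap χ hβ Q X
    _ ≤ ∑ h ∈ (Icc 1 X).filter (fun h => Nat.Coprime h Q ∧ h ≠ 1),
          ‖divisorSumChar χ h‖ / h * H ^ 2 := sum_le_sum hT
    _ ≤ ∑ h ∈ Ioc Y X, ‖divisorSumChar χ h‖ / h * H ^ 2 :=
        sum_le_sum_of_subset_of_nonneg hsub fun h _ _ => by positivity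
    _ = H ^ 2 * ∑ h ∈ Ioc Y X, ‖divisorSumChar χ h‖ / h := by rw [← sum_mul, mul_comm]

end Literature.NumberTheory.LFunctions.Zhang2022.AppendixBVarrho
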